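import Summits.QuantumFields.YangMills.Theorems.BalabanLadderUVSeamRecCeilingsDLRPeelingLinearBudgetSlices
import HarnessLib

/-!
# Crux `UVSeamRec` (stmt-QuantumFields-20043), lane B: the WINDOW-CELL-LAW ⇒ doubled-moments engine with a LINEAR budget — g3's v7 currency
# (window cell laws at the levels `k ≥ 1`) with the PLAIN sum `Σ_k δ_k` of the activities instead of `Σ_k δ_k^{1/16}`

Helper file (`--supports stmt-QuantumFields-20043`) of the width-lever seat `ym-20043-ceilings-p2` (lane B, gen 8); the window-cell-law twin of
`…CeilingsDLRPeelingLinearBudget` (the (UCR) engine with a linear budget).  g3's `TemperedResponse.torusE_exp_two_mul_sum_influence_le_of_windowCellLaws`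
(p554392) needs level weights `θ_k` with `δ_k ≤ θ_k^{16}` — the sixteenth root paid for the sign classes under Hölder exponents `p_k ∝ 1/Λ_k`.  With the
geometric exponents of `integral_exp_two_mul_sum_le_of_levels` the sign classes cost a factor `16` INSIDE the exponential weight, which is `≤ 1` at
every depth `j ≥ 2` below the top shell level (`64(2/b⁴)^j ≤ 1`), so:
* `torusE_exp_sum_indicator_le_of_windowCellLaw` — a window cell law (product law with activity `δ` on the window families of level `k`) gives, on
  every window family, `⟨exp(Σ_A t_γ1_γ∘lift)⟩ ≤ exp(Σ_A (e^{t_γ} − 1)δ)` (ideal-gas expansion, p527372).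
* `wcl_weight_le_one` — the depth-`j ≥ 2` weight `16·(2^{j+1}·2·Λ_{K−j}) ≤ 1`.
* `torusE_exp_two_mul_sum_influence_le_of_windowCellLaws_linear` — fundamental `SU(N)`, odd torus `2L+1`, `β ≥ 1`, REDUCED `2R+4`-separated family,
  any block size; activities `δ_k ≥ 0` with the window cell laws at every level `k ≥ 1`:
  `⟨exp(2Σ_{i∈T} influence 𝔟 ε kmax R (x i)∘lift)⟩_{2L+1,β} ≤ exp((6144 + 2(e−1)·1536·(δ₀(β) + Σ_{1≤k≤kmax} δ_k))·#T)`.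
  The sequel `…WindowCellLawsLinearGlue` carries this to (RM) and to a v7-shaped glue with the summability clause `Σ_{1≤k≤kmax β R} δ β k ≤ D`.
HONEST FRAMING.  Folklore probability; the window cell laws at the levels `k ≥ 1` are OPEN (Bałaban-type large-field estimates one scale at a time on
every odd torus; inhabited only in the far UV, p563207/p566822); nothing of E0′; not a gap, not Clay.  References: folklore; T. Bałaban, Commun. Math.
Phys. 122 (1989) 355–392.
-/

set_option autoImplicit false

noncomputable section

open MeasureTheory Filter Topology Finset
open Literature.Probability.LatticeModels
open Literature.MathematicalPhysics.QuantumFieldTheory (GaugeConfig wilsonMeasure LatticeRep isProbabilityMeasure_wilsonMeasure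
  measurable_torusLift)
open Literature.MathematicalPhysics.QuantumLattice (LGConfig torusLift IsCylinder ymSpecification isProbabilityMeasure_ymSpecification
  integrable_of_abs_le fundamentalLatticeRep)

namespace Summit.QuantumFields.YangMills.Cruxes.UVSeamRec.DLRPeeling

open Summit.QuantumFields.YangMills.Cruxes.OSLegsFromFemtoAndGap.DlrCollarTransfer
open Summit.QuantumFields.YangMills.Cruxes.UVSeamRec.PolymerData
open Summit.QuantumFields.YangMills.Cruxes.UVSeamRec.TemperedResponse
open Summit.QuantumFields.YangMills.Cruxes.UVSeamRec.DefectCollar (integral_prod_indicator_eq_measureReal)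
open Summit.QuantumFields.YangMills.Theorems.OddTorusChessboard (Orient)

/-! ## §1 A window cell law in the exponential currency; the depth weight -/

section CellLaw

variable {N : ℕ} [NeZero N]

/-- **A window cell law in the exponential currency.**  Fundamental `SU(N)`, odd torus `2L+1`, any `β`; if the product law
`⟨∏_{γ∈A} 1_{largeFieldEvent 𝔟 ε γ}∘lift⟩ ≤ δ^{#A}` (`δ ≥ 0`) holds for every family of level-`k` block-plaquettes whose blocks fit in the period window
`[o, o+2L+1)⁴`, then for every such family and coefficients `t_γ ≥ 0`: `⟨exp(Σ_{γ∈A} t_γ1_γ∘lift)⟩ ≤ exp(Σ_{γ∈A}(e^{t_γ} − 1)δ)` (window families are closed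
under subfamilies; ideal-gas expansion p527372 `PolymerRarity.integral_exp_sum_indicator_le_prod`; `1 + x ≤ e^x`).  Written with the constant `K'' = 1`
of `slice_exp_moment_deep`. [folklore] -/
theorem torusE_exp_sum_indicator_le_of_windowCellLaw (β : ℝ) (𝔟 : BlockSize) (ε : ℝ) (k L : ℕ) {δ : ℝ} (hδ : 0 ≤ δ)
    (o : Fin 4 → ℤ)
    (hWCL : ∀ A : Finset Polymer, (∀ γ ∈ A, γ.k = k) →
      (∀ γ ∈ A, ∀ c, o c ≤ anchor 𝔟 γ c ∧ anchor 𝔟 γ c + (𝔟.b : ℤ) ^ k ≤ o c + (2 * L + 1)) →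
      torusE (Matrix.specialUnitaryGroup (Fin N) ℂ) (fundamentalLatticeRep N) β L (fun U => ∏ γ ∈ A,
        (largeFieldEvent (N := N) 𝔟 ε γ).indicator (fun _ => (1 : ℝ)) U) ≤ ∏ _γ ∈ A, δ)
    (A : Finset Polymer) (hA : ∀ γ ∈ A, γ.k = k)
    (hwin : ∀ γ ∈ A, ∀ c, o c ≤ anchor 𝔟 γ c ∧ anchor 𝔟 γ c + (𝔟.b : ℤ) ^ k ≤ o c + (2 * L + 1))
    (t : Polymer → ℝ) (ht : ∀ γ ∈ A, 0 ≤ t γ) :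
    torusE (Matrix.specialUnitaryGroup (Fin N) ℂ) (fundamentalLatticeRep N) β L (fun U => Real.exp (∑ γ ∈ A,
        t γ * (largeFieldEvent (N := N) 𝔟 ε γ).indicator (fun _ => (1 : ℝ)) U)) ≤
      Real.exp (1 / (1 : ℝ) * ∑ γ ∈ A, (Real.exp ((1 : ℝ) * t γ) - 1) * δ) := by
  classical
  haveI := isProbabilityMeasure_wilsonMeasure (d := 4) (L := 2 * L + 1) (fundamentalLatticeRep N).ρ
    (fundamentalLatticeRep N).continuous β
  set μT := wilsonMeasure (d := 4) (L := 2 * L + 1) (fundamentalLatticeRep N).ρ β with hμT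
  set E' : Polymer → Set (GaugeConfig 4 (2 * L + 1) (Matrix.specialUnitaryGroup (Fin N) ℂ)) := fun γ =>
    (torusLift (2 * L + 1)) ⁻¹' largeFieldEvent (N := N) 𝔟 ε γ with hE'
  have hE'm : ∀ γ, MeasurableSet (E' γ) := fun γ =>
    measurableSet_preimage (measurable_torusLift _) (measurableSet_largeFieldEvent (N := N) 𝔟 ε γ)
  have hind : ∀ γ (U : GaugeConfig 4 (2 * L + 1) (Matrix.specialUnitaryGroup (Fin N) ℂ)),
      (E' γ).indicator (fun _ => (1 : ℝ)) U = (largeFieldEvent (N := N) 𝔟 ε γ).indicator (fun _ => (1 : ℝ)) (torusLift (2 * L + 1) U) := by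
    intro γ U
    simp only [hE', Set.indicator_apply, Set.mem_preimage]
  have hPL : ∀ B, B ⊆ A → μT.real (⋂ γ ∈ B, E' γ) ≤ ∏ _γ ∈ B, δ := by
    intro B hB
    have hlaw := hWCL B (fun γ hγ => hA γ (hB hγ)) (fun γ hγ => hwin γ (hB hγ))
    rw [← integral_prod_indicator_eq_measureReal μT B E' hE'm]
    have : ∫ U, ∏ γ ∈ B, (E' γ).indicator (fun _ => (1 : ℝ)) U ∂μT =
        torusE (Matrix.specialUnitaryGroup (Fin N) ℂ) (fundamentalLatticeRep N) β L (fun U => ∏ γ ∈ B,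
          (largeFieldEvent (N := N) 𝔟 ε γ).indicator (fun _ => (1 : ℝ)) U) := by
      unfold torusE
      exact integral_congr_ae (ae_of_all _ fun U => Finset.prod_congr rfl fun γ _ => hind γ U)
    rw [this]
    exact hlaw
  have key := PolymerRarity.integral_exp_sum_indicator_le_prod μT A E' hE'm t (fun _ => δ) ht hPL
  have hlhs : torusE (Matrix.specialUnitaryGroup (Fin N) ℂ) (fundamentalLatticeRep N) β L (fun U => Real.exp (∑ γ ∈ A,
      t γ * (largeFieldEvent (N := N) 𝔟 ε γ).indicator (fun _ => (1 : ℝ)) U)) =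
      ∫ U, Real.exp (∑ γ ∈ A, t γ * (E' γ).indicator (fun _ => (1 : ℝ)) U) ∂μT := by
    unfold torusE
    exact integral_congr_ae (ae_of_all _ fun U => by simp only [hind])
  rw [hlhs, div_one, one_mul]
  simp only [one_mul]
  refine key.trans ?_
  calc ∏ γ ∈ A, (1 + (Real.exp (t γ) - 1) * δ) ≤ ∏ γ ∈ A, Real.exp ((Real.exp (t γ) - 1) * δ) := by
        refine Finset.prod_le_prod (fun γ hγ => ?_) fun γ hγ => ?_
        · have : 0 ≤ (Real.exp (t γ) - 1) * δ := mul_nonneg (by linarith [Real.one_le_exp (ht γ hγ)]) hδ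
          linarith
        · have := Real.add_one_le_exp ((Real.exp (t γ) - 1) * δ)
          linarith
    _ = Real.exp (∑ γ ∈ A, (Real.exp (t γ) - 1) * δ) := by rw [Real.exp_sum]

/-- **The depth weight of the window-cell-law currency is at most `1` from depth `2` on**: `2b^K ≤ R`, `k + j = K`, `j ≥ 2`, `a` under the level cap ⇒
`16·1·(2^{j+1}·2·a) ≤ 1` (`64(2/b⁴)^j ≤ 64/32² < 1`). [folklore] -/
theorem wcl_weight_le_one (𝔟 : BlockSize) {R K k j : ℕ} (hK : 2 * 𝔟.b ^ K ≤ R) (hkj : k + j = K) (hj : 2 ≤ j)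
    {a : ℝ} (ha : a ≤ 16 * ((𝔟.b : ℝ) ^ k / ((R : ℝ) + 2 + 2 * (𝔟.b : ℝ) ^ k)) ^ 4) :
    16 * (1 : ℝ) * ((2 : ℝ) ^ (j + 1) * 2 * a) ≤ 1 := by
  have hcap := ha.trans (levelCap_le_inv_pow 𝔟 hK hkj)
  have hb3 : (3 : ℝ) ≤ (𝔟.b : ℝ) := by exact_mod_cast BlockFieldLocality.three_le_b 𝔟
  have hb4 : (81 : ℝ) ≤ (𝔟.b : ℝ) ^ 4 := by
    have h := pow_le_pow_left₀ (by norm_num : (0 : ℝ) ≤ 3) hb3 4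
    norm_num at h
    exact h
  have hq : 2 / (𝔟.b : ℝ) ^ 4 ≤ 1 / 32 := by
    rw [div_le_div_iff₀ (by positivity) (by norm_num)]; linarith
  have hq0 : 0 ≤ 2 / (𝔟.b : ℝ) ^ 4 := by positivity
  calc 16 * (1 : ℝ) * ((2 : ℝ) ^ (j + 1) * 2 * a)
      ≤ 16 * (1 : ℝ) * ((2 : ℝ) ^ (j + 1) * 2 * (1 / ((𝔟.b : ℝ) ^ 4) ^ j)) :=
        mul_le_mul_of_nonneg_left (mul_le_mul_of_nonneg_left hcap (by positivity)) (by positivity)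
    _ = 64 * (2 / (𝔟.b : ℝ) ^ 4) ^ j := by rw [div_pow, pow_succ]; ring
    _ ≤ 64 * ((1 : ℝ) / 32) ^ 2 := by
        refine mul_le_mul_of_nonneg_left ?_ (by norm_num)
        exact (pow_le_pow_left₀ hq0 hq j).trans (pow_le_pow_of_le_one (by norm_num) (by norm_num) hj)
    _ ≤ 1 := by norm_num

end CellLaw

/-! ## §2 The linear-budget engine in the window-cell-law currency -/

section Linear

variable {N : ℕ} [NeZero N]

/-- **DOUBLED JOINT EXPONENTIAL MOMENTS OF THE INFLUENCE FUNCTIONALS FROM WINDOW CELL LAWS WITH A LINEAR BUDGET.**  Fundamental Wilson state of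
`SU(N)` on the odd torus `2L+1`, `β ≥ 1`; a REDUCED cube family (`|x i c| ≤ L`), pairwise cyclically `2R+4`-separated, `1 ≤ R`, `4R+8 ≤ L`; ANY odd block
size `𝔟`, thresholds `ε`, cutoff `kmax`; activities `δ k ≥ 0` with the WINDOW CELL LAWS at every level `k ≥ 1`: for every window origin `o` and every finite
family `A` of level-`k` block-plaquettes whose blocks fit in `[o, o+2L+1)⁴`, `⟨∏_{γ∈A} 1_{largeFieldEvent 𝔟 (ε k) γ}∘lift⟩ ≤ ∏_{γ∈A} δ k`.  THEN, with the
constants `K₀, D₁` of the proved level-`0` law, `⟨exp(2 Σ_{i∈T} influence 𝔟 ε kmax R (x i)∘lift)⟩_{2L+1,β} ≤ exp((6144 + 2(e−1)·1536·(δ₀ + Σ_{1≤k≤kmax} δ k))·#T)`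
— LINEAR in the activities (g3's p554392 had `2e²·1536·(δ₀ + Σ θ_k)` with `δ_k ≤ θ_k^{16}`).  Proof: as `…_of_uniformConditionalRarity_linear` with the
window-family law `torusE_exp_sum_indicator_le_of_windowCellLaw` (constant `1`) in place of the peeling; only the depths `j ≤ 1` are trivial. [folklore] -/
theorem torusE_exp_two_mul_sum_influence_le_of_windowCellLaws_linear :
    ∃ K₀ : ℝ, ∃ D₁ : ℕ, ∀ (𝔟 : BlockSize) (ε : ℕ → ℝ) (kmax R L : ℕ) (β : ℝ), 1 ≤ β →
      ∀ {n : ℕ} (x : Fin n → (Fin 4 → ℤ)), 1 ≤ R → 4 * R + 8 ≤ L → (∀ i c, |x i c| ≤ (L : ℤ)) →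
      (∀ i j : Fin n, i ≠ j → ∃ k : Fin 4,
        (2 * (R : ℤ) + 4) ≤ |((((x i k - x j k : ℤ) : ZMod (2 * L + 1))).valMinAbs : ℤ)|) →
      ∀ (δ : ℕ → ℝ), (∀ k, 0 ≤ δ k) →
      (∀ k : ℕ, 1 ≤ k → ∀ (o : Fin 4 → ℤ) (A : Finset Polymer), (∀ γ ∈ A, γ.k = k) →
        (∀ γ ∈ A, ∀ c, o c ≤ anchor 𝔟 γ c ∧ anchor 𝔟 γ c + (𝔟.b : ℤ) ^ k ≤ o c + (2 * L + 1)) →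
        torusE (Matrix.specialUnitaryGroup (Fin N) ℂ) (fundamentalLatticeRep N) β L (fun U => ∏ γ ∈ A,
          (largeFieldEvent (N := N) 𝔟 (ε k) γ).indicator (fun _ => (1 : ℝ)) U) ≤ ∏ _γ ∈ A, δ k) →
      ∀ T : Finset (Fin n),
        torusE (Matrix.specialUnitaryGroup (Fin N) ℂ) (fundamentalLatticeRep N) β L
            (fun U => Real.exp (((2 : ℕ) : ℝ) * ∑ i ∈ T, influence (N := N) 𝔟 ε kmax R (x i) U)) ≤
          Real.exp ((6144 + 2 * (Real.exp 1 - 1) * 1536 *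
            (Real.exp (-(β * ((N : ℝ) * ε 0)) / Fintype.card (Orient 4) + (K₀ + D₁ * Real.log β) / Fintype.card (Orient 4)) +
              ∑ k ∈ (Finset.range (kmax + 1)).filter (fun k => 1 ≤ k), δ k)) * T.card) := by
  classical
  obtain ⟨K₀, D₁, hPL0⟩ := torusE_exp_sum_indicator_levelZero_le (N := N)
  refine ⟨K₀, D₁, ?_⟩
  intro 𝔟 ε kmax R L β hβ n x hR hRL hred hsep w hw0 hWCL T
  haveI := isProbabilityMeasure_wilsonMeasure (d := 4) (L := 2 * L + 1) (fundamentalLatticeRep N).ρ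
    (fundamentalLatticeRep N).continuous β
  have hL : 1 ≤ L := by omega
  set μT := wilsonMeasure (d := 4) (L := 2 * L + 1) (fundamentalLatticeRep N).ρ β with hμT
  set δ₀ : ℝ := Real.exp (-(β * ((N : ℝ) * ε 0)) / Fintype.card (Orient 4) + (K₀ + D₁ * Real.log β) / Fintype.card (Orient 4))
    with hδ₀def
  have hδ₀0 : 0 ≤ δ₀ := (Real.exp_pos _).le
  set cD : ℝ := 2 * (Real.exp 1 - 1) * 1536 with hcDdef
  have he1 : 1 ≤ Real.exp 1 - 1 := by have := Real.add_one_le_exp (1 : ℝ); linarith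
  have hcD0 : 0 ≤ cD := by rw [hcDdef]; nlinarith
  set Wsum : ℝ := ∑ k ∈ (Finset.range (kmax + 1)).filter (fun k => 1 ≤ k), w k with hWsum
  have hW0 : 0 ≤ Wsum := Finset.sum_nonneg fun k _ => hw0 k
  have hT0 : (0 : ℝ) ≤ T.card := Nat.cast_nonneg _
  have hB0 : 0 ≤ (6144 + cD * (δ₀ + Wsum)) * T.card := by positivity
  -- the slices `J_k`
  let S : ℕ → Finset Polymer := fun k => (familyShell 𝔟 kmax R x).filter (fun γ => γ.k = k)
  have hSk : ∀ k, ∀ γ ∈ S k, γ.k = k := fun k γ hγ => (Finset.mem_filter.1 hγ).2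
  have hSsub : ∀ k, S k ⊆ familyShell 𝔟 kmax R x := fun k => Finset.filter_subset _ _
  let a : Polymer → ℝ := fun γ => ∑ i ∈ T, familyCoeff 𝔟 kmax R x i γ
  have ha0 : ∀ γ, 0 ≤ a γ := fun γ => Finset.sum_nonneg fun i _ => familyCoeff_nonneg 𝔟 kmax R x i γ
  have hacap : ∀ γ, a γ ≤ 16 * ((𝔟.b : ℝ) ^ γ.k / ((R : ℝ) + 2 + 2 * (𝔟.b : ℝ) ^ γ.k)) ^ 4 := fun γ =>
    (Finset.sum_le_univ_sum_of_nonneg fun i => familyCoeff_nonneg 𝔟 kmax R x i γ).trans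
      (sum_familyCoeff_le_levelCap' 𝔟 kmax R hRL x hsep γ)
  let J : ℕ → GaugeConfig 4 (2 * L + 1) (Matrix.specialUnitaryGroup (Fin N) ℂ) → ℝ := fun k U =>
    ∑ γ ∈ S k, a γ * (largeFieldEvent (N := N) 𝔟 (ε γ.k) γ).indicator (fun _ => (1 : ℝ)) (torusLift (2 * L + 1) U)
  have hχ01 : ∀ γ (U : LGConfig 4 (Matrix.specialUnitaryGroup (Fin N) ℂ)),
      0 ≤ (largeFieldEvent (N := N) 𝔟 (ε γ.k) γ).indicator (fun _ => (1 : ℝ)) U ∧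
        (largeFieldEvent (N := N) 𝔟 (ε γ.k) γ).indicator (fun _ => (1 : ℝ)) U ≤ 1 := fun γ U =>
    ⟨Set.indicator_nonneg (fun _ _ => zero_le_one) _, Set.indicator_apply_le' (fun _ => le_rfl) (fun _ => zero_le_one)⟩
  have hJm : ∀ k, Measurable (J k) := fun k => Finset.measurable_sum _ fun γ _ =>
    ((measurable_const.indicator (measurableSet_largeFieldEvent (N := N) 𝔟 _ γ)).comp (measurable_torusLift _)).const_mul _
  have hJ0 : ∀ k U, 0 ≤ J k U := fun k U => Finset.sum_nonneg fun γ _ => mul_nonneg (ha0 γ) (hχ01 γ _).1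
  have hJle : ∀ k U, J k U ≤ 1536 * T.card := by
    intro k U
    have hmass : ∑ γ ∈ S k, a γ ≤ 1536 * T.card := by
      calc ∑ γ ∈ S k, a γ = ∑ i ∈ T, ∑ γ ∈ S k, familyCoeff 𝔟 kmax R x i γ := Finset.sum_comm
        _ ≤ ∑ _i ∈ T, (1536 : ℝ) := Finset.sum_le_sum fun i _ => sum_familyCoeff_slice_le 𝔟 kmax R x i k (S k) (hSk k)
        _ = 1536 * T.card := by rw [Finset.sum_const, nsmul_eq_mul, mul_comm]
    exact (Finset.sum_le_sum fun γ _ => by simpa using mul_le_mul_of_nonneg_left (hχ01 γ _).2 (ha0 γ)).trans hmass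
  have hJb : ∀ k U, |J k U| ≤ 1536 * T.card := fun k U => by rw [abs_of_nonneg (hJ0 k U)]; exact hJle k U
  -- the left-hand side in sliced form
  have hlhs : torusE (Matrix.specialUnitaryGroup (Fin N) ℂ) (fundamentalLatticeRep N) β L
      (fun U => Real.exp (((2 : ℕ) : ℝ) * ∑ i ∈ T, influence (N := N) 𝔟 ε kmax R (x i) U)) =
      ∫ U, Real.exp (2 * ∑ k ∈ Finset.range (kmax + 1), J k U) ∂μT := by
    unfold torusE
    refine integral_congr_ae (ae_of_all _ fun U => ?_)
    simp only [J, S, a, Nat.cast_ofNat, sum_influence_eq_sum_slices (N := N) 𝔟 ε kmax R x T]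
  rw [hlhs]
  -- Case `R = 1`: no shell polymers at all
  by_cases hR2 : 2 * 𝔟.b ^ 0 ≤ R
  swap
  · have hempty : ∀ k, S k = ∅ := by
      intro k
      refine Finset.eq_empty_of_forall_notMem fun γ hγ => ?_
      obtain ⟨i, _, hi⟩ := Finset.mem_biUnion.1 (hSsub k hγ)
      have hsh := (mem_shell_iff 𝔟 kmax R (x i) γ).1 hi
      have h2 : 2 * 𝔟.b ^ γ.k ≤ R := by have := hsh.2.1.trans hsh.2.2; omega
      have h1 : 𝔟.b ^ 0 ≤ 𝔟.b ^ γ.k := Nat.pow_le_pow_right 𝔟.pos (Nat.zero_le _)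
      exact hR2 (by omega)
    have hJ : ∀ k U, J k U = 0 := fun k U => by simp only [J, hempty, Finset.sum_empty]
    simp only [hJ, Finset.sum_const_zero, mul_zero, Real.exp_zero, integral_const, smul_eq_mul, mul_one, probReal_univ]
    exact Real.one_le_exp hB0
  -- the top shell level `K`
  set K : ℕ := Nat.findGreatest (fun k => 2 * 𝔟.b ^ k ≤ R) kmax with hKdef
  have hK2 : 2 * 𝔟.b ^ K ≤ R := Nat.findGreatest_spec (P := fun k => 2 * 𝔟.b ^ k ≤ R) (Nat.zero_le kmax) hR2
  have hKle : K ≤ kmax := Nat.findGreatest_le kmax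
  have hzero : ∀ k, K < k → k ≤ kmax → ∀ U, J k U = 0 := by
    intro k hk hk' U
    have hS : S k = ∅ := by
      refine Finset.eq_empty_of_forall_notMem fun γ hγ => ?_
      obtain ⟨i, _, hi⟩ := Finset.mem_biUnion.1 (hSsub k hγ)
      have hsh := (mem_shell_iff 𝔟 kmax R (x i) γ).1 hi
      have h2 : 2 * 𝔟.b ^ γ.k ≤ R := by have := hsh.2.1.trans hsh.2.2; omega
      rw [hSk k γ hγ] at h2
      exact Nat.findGreatest_is_greatest (P := fun k => 2 * 𝔟.b ^ k ≤ R) hk hk' h2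
    simp only [J, hS, Finset.sum_empty]
  -- constants of the levels
  let θ : ℕ → ℝ := fun k => if k = 0 then δ₀ else w k
  have hθ0 : ∀ k, 0 ≤ θ k := fun k => by by_cases hk : k = 0 <;> simp [θ, hk, hδ₀0, hw0]
  let C : ℕ → ℝ := fun j => if j ≤ 1 then 3072 * T.card else cD * θ (K - j) * T.card
  -- the window-family laws in the exponential currency: level `k ≥ 1` (window cell laws) and level `0` (plaquette law)
  have hWF : ∀ k : ℕ, 1 ≤ k →
      ∀ (o : Fin 4 → ℤ) (A : Finset Polymer), A ⊆ familyShell 𝔟 kmax R x → (∀ γ ∈ A, γ.k = k) →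
      (∀ γ ∈ A, ∀ c, o c ≤ anchor 𝔟 γ c ∧ anchor 𝔟 γ c + (𝔟.b : ℤ) ^ k ≤ o c + (2 * L + 1)) →
      ∀ t : Polymer → ℝ, (∀ γ ∈ A, 0 ≤ t γ) →
      torusE (Matrix.specialUnitaryGroup (Fin N) ℂ) (fundamentalLatticeRep N) β L (fun U => Real.exp (∑ γ ∈ A,
        t γ * (largeFieldEvent (N := N) 𝔟 (ε k) γ).indicator (fun _ => (1 : ℝ)) U)) ≤
        Real.exp (1 / (1 : ℝ) * ∑ γ ∈ A, (Real.exp ((1 : ℝ) * t γ) - 1) * w k) :=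
    fun k hk o A _ hA hwin t ht =>
      torusE_exp_sum_indicator_le_of_windowCellLaw (N := N) β 𝔟 (ε k) k L (hw0 k) o (fun A' hA' hwin' => hWCL k hk o A' hA' hwin')
        A hA hwin t ht
  have hWF0 : ∀ (o : Fin 4 → ℤ) (A : Finset Polymer), A ⊆ familyShell 𝔟 kmax R x → (∀ γ ∈ A, γ.k = 0) →
      (∀ γ ∈ A, ∀ c, o c ≤ anchor 𝔟 γ c ∧ anchor 𝔟 γ c + (𝔟.b : ℤ) ^ (0 : ℕ) ≤ o c + (2 * L + 1)) →
      ∀ t : Polymer → ℝ, (∀ γ ∈ A, 0 ≤ t γ) →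
      torusE (Matrix.specialUnitaryGroup (Fin N) ℂ) (fundamentalLatticeRep N) β L (fun U => Real.exp (∑ γ ∈ A,
        t γ * (largeFieldEvent (N := N) 𝔟 (ε 0) γ).indicator (fun _ => (1 : ℝ)) U)) ≤
        Real.exp (1 / (1 : ℝ) * ∑ γ ∈ A, (Real.exp ((1 : ℝ) * t γ) - 1) * δ₀) := by
    intro o A _ hA hwin t ht
    have h := hPL0 𝔟 (ε 0) L hL β hβ o A hA hwin t ht
    simpa only [one_mul, div_one, hδ₀def] using h
  -- per-level Hölder bounds
  have hmom : ∀ j, j ≤ K → ∫ U, Real.exp ((2 : ℝ) ^ (j + 1) * (2 * J (K - j) U)) ∂μT ≤ Real.exp ((2 : ℝ) ^ (j + 1) * C j) := by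
    intro j hjK
    set k := K - j with hkdef
    have hkj : k + j = K := by omega
    have hc : (0 : ℝ) ≤ (2 : ℝ) ^ (j + 1) * 2 := by positivity
    have hassoc : ∀ U, (2 : ℝ) ^ (j + 1) * (2 * J k U) = (2 : ℝ) ^ (j + 1) * 2 * J k U := fun U => by ring
    simp only [hassoc]
    by_cases htop : j ≤ 1
    · -- a top level: trivial bound by the coefficient mass
      have hCj : C j = 3072 * T.card := if_pos htop
      rw [hCj, show (2 : ℝ) ^ (j + 1) * (3072 * (T.card : ℝ)) = (2 : ℝ) ^ (j + 1) * 2 * (1536 * T.card) by ring]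
      exact slice_exp_moment_trivial (N := N) β 𝔟 ε kmax R L k x T hc
    -- a deep level: peeling of exponential weights, linearised
    have hdeep : 2 ≤ j := by omega
    have hCj : C j = cD * θ k * T.card := by simp only [C, if_neg htop, hkdef]
    rw [hCj]
    have hsmall : ∀ γ ∈ S k, 16 * (1 : ℝ) * ((2 : ℝ) ^ (j + 1) * 2 * a γ) ≤ 1 := by
      intro γ hγ
      have h1 := hacap γ
      rw [hSk k γ hγ] at h1
      exact wcl_weight_le_one 𝔟 hK2 hkj hdeep h1
    by_cases hk0 : k = 0
    · -- level `0`: the proved plaquette law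
      have hθk : θ k = δ₀ := by simp only [θ, hk0, if_true]
      have hsmall0 : ∀ γ ∈ (familyShell 𝔟 kmax R x).filter (fun γ => γ.k = 0),
          16 * (1 : ℝ) * ((2 : ℝ) ^ (j + 1) * 2 * ∑ i ∈ T, familyCoeff 𝔟 kmax R x i γ) ≤ 1 := by
        intro γ hγ
        rw [← hk0] at hγ
        exact hsmall γ hγ
      have h := slice_exp_moment_deep (N := N) β 𝔟 (ε 0) kmax R L 0 hRL x hred T one_pos hδ₀0 hWF0 hc hsmall0
      rw [hθk, show (2 : ℝ) ^ (j + 1) * (cD * δ₀ * (T.card : ℝ)) = (2 : ℝ) ^ (j + 1) * 2 * ((Real.exp 1 - 1) * 1536 * δ₀ * T.card) by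
        rw [hcDdef]; ring]
      refine (le_of_eq ?_).trans h
      refine integral_congr_ae (ae_of_all _ fun U => congrArg Real.exp (congrArg _ ?_))
      rw [hk0]
      exact Finset.sum_congr rfl fun γ hγ => by rw [(Finset.mem_filter.1 hγ).2]
    · -- level `k ≥ 1`: peeling
      have hk1 : 1 ≤ k := Nat.one_le_iff_ne_zero.2 hk0
      have hθk : θ k = w k := by simp only [θ, hk0, if_false]
      have h := slice_exp_moment_deep (N := N) β 𝔟 (ε k) kmax R L k hRL x hred T one_pos (hw0 k) (hWF k hk1) hc hsmall
      rw [hθk, show (2 : ℝ) ^ (j + 1) * (cD * w k * (T.card : ℝ)) = (2 : ℝ) ^ (j + 1) * 2 * ((Real.exp 1 - 1) * 1536 * w k * T.card) by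
        rw [hcDdef]; ring]
      refine (le_of_eq ?_).trans h
      refine integral_congr_ae (ae_of_all _ fun U => congrArg Real.exp (congrArg _ ?_))
      exact Finset.sum_congr rfl fun γ hγ => by rw [(Finset.mem_filter.1 hγ).2]
  -- Hölder across the levels
  have key := integral_exp_two_mul_sum_le_of_levels μT J hJm hJb kmax K hKle hzero C hmom
  refine key.trans (Real.exp_le_exp.2 ?_)
  -- the budget: `Σ_{j ≤ K} C j ≤ (6144 + cD(δ₀ + Σ_{1≤k≤kmax} δ k))·#T`
  have hCle : ∀ j ∈ Finset.range (K + 1), C j ≤ 3072 * T.card * (if j ≤ 1 then 1 else 0) + cD * T.card * θ (K - j) := by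
    intro j _
    by_cases htop : j ≤ 1
    · have h1 : C j = 3072 * T.card := if_pos htop
      rw [h1, if_pos htop, mul_one]
      have := mul_nonneg (mul_nonneg hcD0 hT0) (hθ0 (K - j))
      linarith
    · have h1 : C j = cD * θ (K - j) * T.card := if_neg htop
      rw [h1, if_neg htop, mul_zero, zero_add]
      exact le_of_eq (by ring)
  refine (Finset.sum_le_sum hCle).trans ?_
  rw [Finset.sum_add_distrib, ← Finset.mul_sum, ← Finset.mul_sum]
  have hcount : ∑ j ∈ Finset.range (K + 1), (if j ≤ 1 then (1 : ℝ) else 0) ≤ 2 := by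
    rw [Finset.sum_boole]
    have : ((Finset.range (K + 1)).filter (fun j => j ≤ 1)).card ≤ 2 := by
      calc ((Finset.range (K + 1)).filter (fun j => j ≤ 1)).card ≤ (Finset.range 2).card :=
            Finset.card_le_card fun j hj => Finset.mem_range.2 (by have := (Finset.mem_filter.1 hj).2; omega)
        _ = 2 := Finset.card_range _
    exact_mod_cast this
  have hθsum : ∑ j ∈ Finset.range (K + 1), θ (K - j) ≤ δ₀ + Wsum := by
    rw [← Finset.sum_range_reflect (fun j => θ (K - j)) (K + 1)]
    simp only [add_tsub_cancel_right]
    have h2 : ∀ j ∈ Finset.range (K + 1), θ (K - (K - j)) = θ j := fun j hj => by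
      rw [Nat.sub_sub_self (Nat.lt_succ_iff.1 (Finset.mem_range.1 hj))]
    have h0 : θ 0 = δ₀ := if_pos rfl
    have h1 : ∀ i, θ (i + 1) = w (i + 1) := fun i => if_neg (Nat.succ_ne_zero i)
    rw [Finset.sum_congr rfl h2, Finset.sum_range_succ']
    show ((∑ k ∈ Finset.range K, θ (k + 1)) + θ 0) ≤ δ₀ + Wsum
    rw [h0, Finset.sum_congr rfl fun i _ => h1 i, add_comm]
    refine add_le_add le_rfl ?_
    -- `Σ_{i < K} w (i+1) = Σ_{k ∈ Ico 1 (K+1)} w k ≤ Σ_{1 ≤ k ≤ kmax} w k`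
    have h3 : ∑ i ∈ Finset.range K, w (i + 1) = ∑ k ∈ Finset.Ico 1 (K + 1), w k := by
      rw [Finset.sum_Ico_eq_sum_range]
      simp only [add_tsub_cancel_right]
      exact Finset.sum_congr rfl fun i _ => by rw [add_comm]
    rw [h3, hWsum]
    refine Finset.sum_le_sum_of_subset_of_nonneg (fun k hk => ?_) fun k _ _ => hw0 k
    simp only [Finset.mem_Ico, Finset.mem_filter, Finset.mem_range] at hk ⊢
    exact ⟨by omega, hk.1⟩
  have h3072 : (0 : ℝ) ≤ 3072 * T.card := by positivity
  have hcDT : 0 ≤ cD * T.card := by positivity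
  calc 3072 * (T.card : ℝ) * ∑ j ∈ Finset.range (K + 1), (if j ≤ 1 then (1 : ℝ) else 0) +
        cD * T.card * ∑ j ∈ Finset.range (K + 1), θ (K - j)
      ≤ 3072 * (T.card : ℝ) * 2 + cD * T.card * (δ₀ + Wsum) :=
        add_le_add (mul_le_mul_of_nonneg_left hcount h3072) (mul_le_mul_of_nonneg_left hθsum hcDT)
    _ = (6144 + cD * (δ₀ + Wsum)) * T.card := by ring

end Linear

end Summit.QuantumFields.YangMills.Cruxes.UVSeamRec.DLRPeeling

end
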